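import Literature.NumberTheory.Automorphic.UnitaryGroupTorusLineLatticeKAverageTwo
import Literature.NumberTheory.Automorphic.UnitaryGroupTailClassTorusKAverageTwo
import Literature.NumberTheory.Automorphic.UnitaryGroupLineHaarNormalisationTwo
import HarnessLib

/-!
# The normal form of the `K_U`-averaged bracket of `U(J₂)` on the torus: `δ_B(t)⁻¹ Θ_T(t) = G_T((N_{E∕F} d₀ t)⁻¹)`
(Rogawski, *Automorphic Representations of Unitary Groups in Three Variables* (1990), Prop. 7.3.1 p. 98 (`G = U(2)`), §7.3
(7.3.2)–(7.3.3); Tate's truncated theta integrand, Cassels–Fröhlich Ch. XV Lemma 4.1.2 ∕ Thm. 4.1.3.)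

Topic `NumberTheory/Automorphic`; namespace `Literature.NumberTheory.Automorphic.UnitaryGroup`. THEOREMS ONLY over accepted tree
modules (no definition, no named fact, no instance, no notation, no `sorry`). The `N = 2` twin (ET-γ)_two of ★
`torusIntegrand_heisPart_normalForm` (`UnitaryGroupHeisenbergPartTorusNormalForm`) with NO (ET-α) — at `N = 2` the unipotent radical
IS the centre line `N(𝔸_F) ≅ 𝔸_E⁻ ≅ 𝔸_F`, there is no Heisenberg fibre (H-side copy of the LAW trunk of
`Cruxes/H413/Lines/F0_T1InnerFormTraceIdentity.lean` for `H = U(Φ₂) × U(Φ₁)`; cell hodgecm-mathlib, crux H413; CENSUS-LAWS-Hside §3 (σ-u),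
dealt by the (σ-u) head owner A-p17 (g17)). OUTPUT = the `hΘ` binder of ★ F2 `truncatedTraceClass_central_eq_linear_of_normalForm_two`
(`UnitaryGroupUnipotentTermTwo`, p826930) = ★ B-p10 `lineTorusStage_eq_linear_two`'s `hΘ` with `Θ T t := ∫_K ψ_T(t k) dμ_K`, the line
profile `φ(x) = ∫_K f(k⁻¹ (z₁ n(θ x)) k) dμ_K`, `H₁ := H(1)` and `V₀ := 1`, AT EVERY `T > 0` (at `T = 0` that binder is unsatisfiable
for the bracket: the tail is the full `δ_B(t)·(ν𝓕)⁻¹∫_N` term while the cut-off indicator `{‖y‖ < (0∕H₁)⁻¹ = 0}` is empty — §3 gives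
the GUARDED integrand `Θ′` that satisfies it for all `T` and agrees with the bracket average for `T > 0`).

* §1 `lineTorusIntegrand_normalForm_of_parts_two` — POINTWISE in `(T, t)`, `T > 0`, hypotheses-first in the three analytic letters
  (ET-κ)_two `hκ` (★ A-p13 `integral_tsum_line_torus_mul_eq_ideleSum_two`), (ET-β)_two `hβ` (★ `integral_kernelBorelTailClass_torus_mul_eq_two'`),
  (ET-ν)_two `hν` (★-pending `inv_mul_integral_eq_inv_mul_integral_traceZeroLine_two`); the dictionaries `δ_B(t) = ‖N d₀ t‖_F` (★
  `torusRootModulus_diagUnit_eq_ideleNorm_ideleRelNorm_two`), `H(t) = ‖N d₀ t‖_F · H(1)` (★ `borelHeight_torus_mul'`, ★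
  `glDiagonal_diagUnit_torus`, ★ `ideleNorm_ideleRelNorm_quadratic`) are DISCHARGED inside:
  `δ_B(t)⁻¹ • ∫_K (Σ'_{u ≠ 1} f((tk)⁻¹ z₁ u (tk)) − K^T_{B,𝔬}(tk, tk)) dμ_K = (Σφ(x_t) − ‖x_t‖⁻¹ 1_{‖x_t‖ < (T∕H(1))⁻¹} μ_A(D_F)⁻¹ 𝔉φ(0)) · ‖x_t‖`,
  `x_t = (N_{E∕F} d₀ t)⁻¹`.
* §2 `lineTorusIntegrand_normalForm_of_parts_two'` — the same for the (ET-κ)∕(ET-β) letters DISCHARGED by name (★ A-p13 (C-K)_two FILE 2,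
  ★ (ET-β)_two), hypotheses-first only in (ET-ν)_two `hν`.
* §3 **`lineTorusIntegrand_normalForm_two`** — ALL THREE letters discharged (★ (ET-ν)_two `inv_mul_integral_eq_inv_mul_integral_traceZeroLine_two`,
  p827073): the `hΘ` body at every `T > 0`; and **`lineTorusIntegrand_normalForm_guarded_two`** — the GUARDED integrand
  `Θ′ T t := if 0 < T then ∫_K ψ_T(t k) dμ_K else δ_B(t) · G_T(x_t)` satisfies ★ `lineTorusStage_eq_linear_two`'s `hΘ` for ALL `T : ℝ≥0`
  (`V₀ = 1`, `H₁ = H(1)`), and IS the bracket average for `T > 0`.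

## References
* J. D. Rogawski, *Automorphic Representations of Unitary Groups in Three Variables*, Ann. of Math. Stud. 123 (1990), Prop. 7.3.1
  (p. 98), §7.3 (7.3.2)–(7.3.3) (pp. 96–98), §2.2 (p. 13) [Rogawski1990].
* J. W. S. Cassels, A. Fröhlich (eds.), *Algebraic Number Theory* (1967), Ch. XV (Tate), Lemma 4.1.2, Thm. 4.1.3 [CasselsFrohlichANT1967].
-/

set_option autoImplicit false

noncomputable section

open MeasureTheory Measure NumberField IsDedekindDomain Set Polynomial
open scoped NNReal ENNReal MatrixGroups
open Literature.NumberTheory.Automorphic.Meyer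

namespace Literature.NumberTheory.Automorphic

namespace UnitaryGroup

variable {F E : Type} [Field F] [NumberField F] [Field E] [NumberField E] [Algebra F E]
  [Algebra.IsQuadraticExtension F E] {c : E ≃ₐ[F] E} {ι : Type*}
  (hij : (((0 : Fin 2) : Fin 2) : ℕ) + 1 = (((1 : Fin 2) : Fin 2) : ℕ)) (hN : 2 = 2 * (((0 : Fin 2) : Fin 2) : ℕ) + 2)

/-! ## §1 The normal form from the parts (pointwise in `(T, t)`, `T > 0`) -/

section Parts

variable {z₁ : (quasiSplit F E c 2).arithmeticSubgroup}
  [LocallyCompactSpace (AdeleRing (𝓞 E) E)]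
  [MeasurableSpace (adelicUnipotent F E c 2)]
  [MeasurableSpace (quasiSplit F E c 2).Adelic]
  [MeasurableSpace (AdeleRing (𝓞 F) F)]

/-- **THE NORMAL FORM OF THE TORUS INTEGRAND OF THE `U(J₂)` UNIPOTENT TERM, FROM THE PARTS** (pointwise in `(T, t)`, `T > 0`).
For `t ∈ T(𝔸_F)` write `d₀ = d₀(t) ∈ 𝕀_E`, `x_t = (N_{E∕F} d₀)⁻¹ ∈ 𝕀_F`. GIVEN, as functions of the print's pointwise steps,
(ET-κ) the `K_U`-average of the `u`-sum `hκ` (`= Σφ(x_t)`, Tate's idele sum of the line profile `φ`), (ET-β) the `K_U`-averaged tail `hβ`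
(`= 1_{T < H(t)} δ_B(t) (ν𝓕)⁻¹ ∫_N f^K(z₁ m) dν`) and (ET-ν) the Haar normalisation `hν` (`(ν𝓕)⁻¹ ∫_N f^K(z₁ m) dν = μ_A(D_F)⁻¹ 𝔉φ(0)`):
`δ_B(t)⁻¹ • ∫_K (Σ'_{u ≠ 1} f((tk)⁻¹ (z₁ u) (tk)) − K^T_{B,𝔬}(tk, tk)) dμ_K = (Σφ(x_t) − ‖x_t‖⁻¹ 1_{‖x_t‖ < (T∕H(1))⁻¹} μ_A(D_F)⁻¹ 𝔉φ(0)) · ‖x_t‖`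
— the `hΘ` binder of ★ `lineTorusStage_eq_linear_two` ∕ ★ `truncatedTraceClass_central_eq_linear_of_normalForm_two` at `(T, t)` with
`H₁ = H(1)`, `V₀ = 1`. Dictionaries: `δ_B(t) = ‖N d₀‖_F` (★ `torusRootModulus_diagUnit_eq_ideleNorm_ideleRelNorm_two`), `H(t) = ‖N d₀‖_F H(1)`
(★ `borelHeight_torus_mul'`, ★ `ideleNorm_ideleRelNorm_quadratic`). [cite: Rogawski1990, Prop. 7.3.1 (p. 98)]
[cite: Rogawski1990, §7.3 (7.3.2)–(7.3.3) (pp. 96–98)] [cite: CasselsFrohlichANT1967, Ch. XV Lemma 4.1.2] -/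
theorem lineTorusIntegrand_normalForm_of_parts_two {cl : (quasiSplit F E c 2).arithmeticSubgroup → ι}
    (ν : Measure (adelicUnipotent F E c 2)) (𝓕 : Set (adelicUnipotent F E c 2)) (i : ι)
    (f : (quasiSplit F E c 2).Adelic → ℂ)
    (μK : Measure ((standardMaximalCompactGL 2 E).comap
      (adelicVal F E c 2 ((StdForm.antidiagonal 2).over E)) : Subgroup (quasiSplit F E c 2).Adelic))
    (μA : Measure (AdeleRing (𝓞 F) F)) (φ : AdeleRing (𝓞 F) F → ℂ)
    {T : ℝ≥0} (hT : 0 < (T : ℝ)) (t : torusInBorel F E c 2)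
    -- (ET-κ) the `K_U`-average of the `u`-sum along the torus
    (hκ : ∫ k, (∑' u : {u : rationalUnipotent F E c 2 // u ≠ 1},
        f ((((t : borelAdelic F E c 2) : (quasiSplit F E c 2).Adelic) * (k : (quasiSplit F E c 2).Adelic))⁻¹ *
          ((z₁ * ⟨(((u.1 : rationalUnipotent F E c 2) : adelicUnipotent F E c 2) : (quasiSplit F E c 2).Adelic),
            (u.1 : rationalUnipotent F E c 2).2⟩ : (quasiSplit F E c 2).arithmeticSubgroup) : (quasiSplit F E c 2).Adelic) *
          (((t : borelAdelic F E c 2) : (quasiSplit F E c 2).Adelic) * (k : (quasiSplit F E c 2).Adelic)))) ∂μK =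
      ideleSum F φ (AdeleRing.ideleRelNorm F E (diagUnit (t : borelAdelic F E c 2).2 0))⁻¹)
    (hκi : Integrable (fun k : ((standardMaximalCompactGL 2 E).comap
        (adelicVal F E c 2 ((StdForm.antidiagonal 2).over E)) : Subgroup (quasiSplit F E c 2).Adelic) =>
      ∑' u : {u : rationalUnipotent F E c 2 // u ≠ 1},
        f ((((t : borelAdelic F E c 2) : (quasiSplit F E c 2).Adelic) * (k : (quasiSplit F E c 2).Adelic))⁻¹ *
          ((z₁ * ⟨(((u.1 : rationalUnipotent F E c 2) : adelicUnipotent F E c 2) : (quasiSplit F E c 2).Adelic),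
            (u.1 : rationalUnipotent F E c 2).2⟩ : (quasiSplit F E c 2).arithmeticSubgroup) : (quasiSplit F E c 2).Adelic) *
          (((t : borelAdelic F E c 2) : (quasiSplit F E c 2).Adelic) * (k : (quasiSplit F E c 2).Adelic)))) μK)
    -- (ET-β) the `K_U`-averaged tail
    (hβ : ∫ k : ((standardMaximalCompactGL 2 E).comap (adelicVal F E c 2 ((StdForm.antidiagonal 2).over E)) :
        Subgroup (quasiSplit F E c 2).Adelic),
      kernelBorelTailClass ν 𝓕 T cl i f
        (((t : borelAdelic F E c 2) : (quasiSplit F E c 2).Adelic) * (k : (quasiSplit F E c 2).Adelic)) ∂μK =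
      (if T < borelHeight (((t : borelAdelic F E c 2)) : (quasiSplit F E c 2).Adelic) then (1 : ℂ) else 0) *
        (((torusRootModulus E 2 (diagUnit (t : borelAdelic F E c 2).2) : ℝ≥0) : ℝ) : ℂ) * ((((ν 𝓕).toReal⁻¹ : ℝ)) : ℂ) *
        ∫ m : adelicUnipotent F E c 2,
          (∫ k : ((standardMaximalCompactGL 2 E).comap (adelicVal F E c 2 ((StdForm.antidiagonal 2).over E)) :
              Subgroup (quasiSplit F E c 2).Adelic),
            f ((k : (quasiSplit F E c 2).Adelic)⁻¹ *
              ((z₁ : (quasiSplit F E c 2).Adelic) * ((m : adelicUnipotent F E c 2) : (quasiSplit F E c 2).Adelic)) *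
              (k : (quasiSplit F E c 2).Adelic)) ∂μK) ∂ν)
    (hβi : Integrable (fun k : ((standardMaximalCompactGL 2 E).comap
        (adelicVal F E c 2 ((StdForm.antidiagonal 2).over E)) : Subgroup (quasiSplit F E c 2).Adelic) =>
      kernelBorelTailClass ν 𝓕 T cl i f
        (((t : borelAdelic F E c 2) : (quasiSplit F E c 2).Adelic) * (k : (quasiSplit F E c 2).Adelic))) μK)
    -- (ET-ν) the Haar normalisation on `N(𝔸_F)`, read on `𝔸_F`
    (hν : ((((ν 𝓕).toReal⁻¹ : ℝ)) : ℂ) *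
        ∫ m : adelicUnipotent F E c 2,
          (∫ k : ((standardMaximalCompactGL 2 E).comap (adelicVal F E c 2 ((StdForm.antidiagonal 2).over E)) :
              Subgroup (quasiSplit F E c 2).Adelic),
            f ((k : (quasiSplit F E c 2).Adelic)⁻¹ *
              ((z₁ : (quasiSplit F E c 2).Adelic) * ((m : adelicUnipotent F E c 2) : (quasiSplit F E c 2).Adelic)) *
              (k : (quasiSplit F E c 2).Adelic)) ∂μK) ∂ν =
      ((μA (adeleFundamentalDomain F)).toReal⁻¹ : ℂ) * adeleFourier F μA φ 0) :
    ((torusRootModulus E 2 (diagUnit (t : borelAdelic F E c 2).2) : ℝ≥0) : ℝ)⁻¹ •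
        (∫ k, ((∑' u : {u : rationalUnipotent F E c 2 // u ≠ 1},
            f ((((t : borelAdelic F E c 2) : (quasiSplit F E c 2).Adelic) * (k : (quasiSplit F E c 2).Adelic))⁻¹ *
              ((z₁ * ⟨(((u.1 : rationalUnipotent F E c 2) : adelicUnipotent F E c 2) : (quasiSplit F E c 2).Adelic),
                (u.1 : rationalUnipotent F E c 2).2⟩ : (quasiSplit F E c 2).arithmeticSubgroup) : (quasiSplit F E c 2).Adelic) *
                (((t : borelAdelic F E c 2) : (quasiSplit F E c 2).Adelic) * (k : (quasiSplit F E c 2).Adelic)))) -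
          kernelBorelTailClass ν 𝓕 T cl i f
            (((t : borelAdelic F E c 2) : (quasiSplit F E c 2).Adelic) * (k : (quasiSplit F E c 2).Adelic))) ∂μK) =
      (ideleSum F φ (AdeleRing.ideleRelNorm F E (diagUnit (t : borelAdelic F E c 2).2 0))⁻¹ -
          ((IdeleClassGroup.ideleNorm F (AdeleRing.ideleRelNorm F E (diagUnit (t : borelAdelic F E c 2).2 0))⁻¹ : ℝ) : ℂ)⁻¹ *
            {y : GaloisRepresentations.ideleGroup F |
                (IdeleClassGroup.ideleNorm F y : ℝ) < ((T : ℝ) / (borelHeight (1 : (quasiSplit F E c 2).Adelic) : ℝ))⁻¹}.indicator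
              (fun _ => ((μA (adeleFundamentalDomain F)).toReal⁻¹ : ℂ) * adeleFourier F μA φ 0)
              (AdeleRing.ideleRelNorm F E (diagUnit (t : borelAdelic F E c 2).2 0))⁻¹) *
        ((IdeleClassGroup.ideleNorm F (AdeleRing.ideleRelNorm F E (diagUnit (t : borelAdelic F E c 2).2 0))⁻¹ : ℝ) : ℂ) := by
  -- names
  set d₀ : GaloisRepresentations.ideleGroup E := diagUnit (t : borelAdelic F E c 2).2 0 with hd₀
  set nrm : ℝ := (IdeleClassGroup.ideleNorm F (AdeleRing.ideleRelNorm F E d₀) : ℝ) with hnrm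
  set H₁ : ℝ := (borelHeight (1 : (quasiSplit F E c 2).Adelic) : ℝ) with hH₁
  set Φ : ℂ := ((μA (adeleFundamentalDomain F)).toReal⁻¹ : ℂ) * adeleFourier F μA φ 0 with hΦ
  set S : ℂ := ideleSum F φ (AdeleRing.ideleRelNorm F E d₀)⁻¹ with hS
  -- the dictionaries
  have hnrm_pos : 0 < nrm := by
    rw [hnrm]; exact_mod_cast pos_iff_ne_zero.2 (ideleNorm_ne_zero (AdeleRing.ideleRelNorm F E d₀))
  have hH₁_pos : 0 < H₁ := by rw [hH₁]; exact_mod_cast borelHeight_pos (1 : (quasiSplit F E c 2).Adelic)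
  have hδ : ((torusRootModulus E 2 (diagUnit (t : borelAdelic F E c 2).2) : ℝ≥0) : ℝ) = nrm := by
    rw [hnrm, torusRootModulus_diagUnit_eq_ideleNorm_ideleRelNorm_two]
  have hx : (IdeleClassGroup.ideleNorm F (AdeleRing.ideleRelNorm F E d₀)⁻¹ : ℝ) = nrm⁻¹ := by
    rw [map_inv, NNReal.coe_inv]
  have hH : (borelHeight (((t : borelAdelic F E c 2)) : (quasiSplit F E c 2).Adelic) : ℝ) = nrm * H₁ := by
    have h := borelHeight_torus_mul' (glDiagonal_diagUnit_torus t) (1 : (quasiSplit F E c 2).Adelic)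
    rw [mul_one] at h
    rw [h, NNReal.coe_mul, hnrm, ideleNorm_ideleRelNorm_quadratic]
  have hiff : T < borelHeight (((t : borelAdelic F E c 2)) : (quasiSplit F E c 2).Adelic) ↔
      (IdeleClassGroup.ideleNorm F (AdeleRing.ideleRelNorm F E d₀)⁻¹ : ℝ) < ((T : ℝ) / H₁)⁻¹ := by
    rw [← NNReal.coe_lt_coe, hH, hx, inv_lt_inv₀ hnrm_pos (div_pos hT hH₁_pos), div_lt_iff₀ hH₁_pos]
  have hnrmC : (nrm : ℂ) ≠ 0 := by exact_mod_cast hnrm_pos.ne'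
  -- split the `K_U`-integral and insert the three letters
  have htail : ∫ k : ((standardMaximalCompactGL 2 E).comap (adelicVal F E c 2 ((StdForm.antidiagonal 2).over E)) :
        Subgroup (quasiSplit F E c 2).Adelic),
      kernelBorelTailClass ν 𝓕 T cl i f
        (((t : borelAdelic F E c 2) : (quasiSplit F E c 2).Adelic) * (k : (quasiSplit F E c 2).Adelic)) ∂μK =
      (if T < borelHeight (((t : borelAdelic F E c 2)) : (quasiSplit F E c 2).Adelic) then (1 : ℂ) else 0) *
        ((nrm : ℝ) : ℂ) * Φ := by
    rw [hβ, mul_assoc, hν, hδ]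
  rw [integral_sub hκi hβi, hκ, htail, Complex.real_smul, hδ]
  by_cases hlt : T < borelHeight (((t : borelAdelic F E c 2)) : (quasiSplit F E c 2).Adelic)
  · have hmem : (AdeleRing.ideleRelNorm F E d₀)⁻¹ ∈
        {y : GaloisRepresentations.ideleGroup F | (IdeleClassGroup.ideleNorm F y : ℝ) < ((T : ℝ) / H₁)⁻¹} := hiff.1 hlt
    rw [if_pos hlt, Set.indicator_of_mem hmem, hx]
    push_cast
    field_simp
  · have hnmem : (AdeleRing.ideleRelNorm F E d₀)⁻¹ ∉
        {y : GaloisRepresentations.ideleGroup F | (IdeleClassGroup.ideleNorm F y : ℝ) < ((T : ℝ) / H₁)⁻¹} :=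
      fun h => hlt (hiff.2 h)
    rw [if_neg hlt, Set.indicator_of_notMem hnmem, hx]
    push_cast
    field_simp
    ring

end Parts

/-! ## §2 The same with (ET-κ)_two and (ET-β)_two discharged by name -/

section Discharged

variable (ζ : ratOne F E c) {z₁ : (quasiSplit F E c 2).arithmeticSubgroup}
  [LocallyCompactSpace (AdeleRing (𝓞 E) E)] [MeasurableSpace (AdeleRing (𝓞 E) E)] [BorelSpace (AdeleRing (𝓞 E) E)]
  [MeasurableSpace (adelicUnipotent F E c 2)] [BorelSpace (adelicUnipotent F E c 2)]
  [MeasurableSpace (quasiSplit F E c 2).Adelic] [BorelSpace (quasiSplit F E c 2).Adelic]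
  [MeasurableSpace (AdeleRing (𝓞 F) F)]

/-- **THE NORMAL FORM OF THE TORUS INTEGRAND OF THE `U(J₂)` UNIPOTENT TERM** (pointwise in `(T, t)`, `T > 0`), the (ET-κ) and (ET-β)
letters DISCHARGED (★ A-p13 `integral_tsum_line_torus_mul_eq_ideleSum_two` + `integrable_tsum_rationalUnipotent_mul_two`; ★
`integral_kernelBorelTailClass_torus_mul_eq_two'` + `integrable_kernelBorelTailClass_torus_mul_two`), hypotheses-first only in the Haar
normalisation (ET-ν) `hν` (★-pending `inv_mul_integral_eq_inv_mul_integral_traceZeroLine_two` of `UnitaryGroupLineHaarNormalisationTwo` at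
`g := f^K(z₁ ·)`, read through `hφ`): for the central class `𝔬 = {charpoly = (X − ζ)²}` of `U(J₂)` (`cl` constant on `γ·N(F)`,
`hclN`), `z₁ = ζ·1`, `f ∈ C_c(G(𝔸_F))`, Haar `μ_K` on `K_U`, the line profile `φ(x) = ∫_K f(k⁻¹ (z₁ n(θ x)) k) dμ_K`, `T > 0` and
`t ∈ T(𝔸_F)`: `δ_B(t)⁻¹ • ∫_K ψ_T(t k) dμ_K = (Σφ(x_t) − ‖x_t‖⁻¹ 1_{‖x_t‖ < (T∕H(1))⁻¹} μ_A(D_F)⁻¹ 𝔉φ(0)) · ‖x_t‖`, `x_t = (N d₀ t)⁻¹`.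
[cite: Rogawski1990, Prop. 7.3.1 (p. 98)] [cite: Rogawski1990, §7.3 (7.3.2)–(7.3.3) (pp. 96–98)] -/
theorem lineTorusIntegrand_normalForm_of_parts_two' {cl : (quasiSplit F E c 2).arithmeticSubgroup → ι}
    (hc : c * c = 1) (hc1 : c ≠ 1)
    (ν : Measure (adelicUnipotent F E c 2)) [ν.IsHaarMeasure]
    {𝓕 : Set (adelicUnipotent F E c 2)} (h𝓕 : IsFundamentalDomain (rationalUnipotent F E c 2) 𝓕 ν)
    (hclN : IsUnipotentInvariantOnBorel F E c 2 cl)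
    (hz₁ : (z₁ : (quasiSplit F E c 2).Adelic) =
      (quasiSplit F E c 2).toAdelic (ratCenter F E c 2 ((StdForm.antidiagonal 2).over E) ζ))
    {i : ι} (hcl : ∀ γ : (quasiSplit F E c 2).arithmeticSubgroup, cl γ = i ↔
      ((adelicVal F E c 2 _ (γ : (quasiSplit F E c 2).Adelic) : GL (Fin 2) (AdeleRing (𝓞 E) E)) :
          Matrix (Fin 2) (Fin 2) (AdeleRing (𝓞 E) E)).charpoly =
        ((X - C ((ζ : Eˣ) : E)) ^ 2).map (algebraMap E (AdeleRing (𝓞 E) E)))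
    {f : (quasiSplit F E c 2).Adelic → ℂ} (hfc : Continuous f) (hf : HasCompactSupport f)
    (μK : Measure ((standardMaximalCompactGL 2 E).comap
      (adelicVal F E c 2 ((StdForm.antidiagonal 2).over E)) : Subgroup (quasiSplit F E c 2).Adelic))
    [μK.IsHaarMeasure]
    {δ : E} (hcδ : c δ = -δ) (hδ : δ ≠ 0)
    (μA : Measure (AdeleRing (𝓞 F) F)) (φ : AdeleRing (𝓞 F) F → ℂ)
    (hφ : ∀ x : AdeleRing (𝓞 F) F, φ x = ∫ k, f ((k : (quasiSplit F E c 2).Adelic)⁻¹ *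
      ((z₁ : (quasiSplit F E c 2).Adelic) *
        ((middleRootUnipotent hij hN (Multiplicative.ofAdd (traceZeroLine F E c hcδ hδ x)) :
          adelicUnipotent F E c 2) : (quasiSplit F E c 2).Adelic)) * (k : (quasiSplit F E c 2).Adelic)) ∂μK)
    {T : ℝ≥0} (hT : 0 < (T : ℝ)) (t : torusInBorel F E c 2)
    -- (ET-ν) the Haar normalisation on `N(𝔸_F)`, read on `𝔸_F`
    (hν : ((((ν 𝓕).toReal⁻¹ : ℝ)) : ℂ) *
        ∫ m : adelicUnipotent F E c 2,
          (∫ k : ((standardMaximalCompactGL 2 E).comap (adelicVal F E c 2 ((StdForm.antidiagonal 2).over E)) :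
              Subgroup (quasiSplit F E c 2).Adelic),
            f ((k : (quasiSplit F E c 2).Adelic)⁻¹ *
              ((z₁ : (quasiSplit F E c 2).Adelic) * ((m : adelicUnipotent F E c 2) : (quasiSplit F E c 2).Adelic)) *
              (k : (quasiSplit F E c 2).Adelic)) ∂μK) ∂ν =
      ((μA (adeleFundamentalDomain F)).toReal⁻¹ : ℂ) * adeleFourier F μA φ 0) :
    ((torusRootModulus E 2 (diagUnit (t : borelAdelic F E c 2).2) : ℝ≥0) : ℝ)⁻¹ •
        (∫ k, ((∑' u : {u : rationalUnipotent F E c 2 // u ≠ 1},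
            f ((((t : borelAdelic F E c 2) : (quasiSplit F E c 2).Adelic) * (k : (quasiSplit F E c 2).Adelic))⁻¹ *
              ((z₁ * ⟨(((u.1 : rationalUnipotent F E c 2) : adelicUnipotent F E c 2) : (quasiSplit F E c 2).Adelic),
                (u.1 : rationalUnipotent F E c 2).2⟩ : (quasiSplit F E c 2).arithmeticSubgroup) : (quasiSplit F E c 2).Adelic) *
                (((t : borelAdelic F E c 2) : (quasiSplit F E c 2).Adelic) * (k : (quasiSplit F E c 2).Adelic)))) -
          kernelBorelTailClass ν 𝓕 T cl i f
            (((t : borelAdelic F E c 2) : (quasiSplit F E c 2).Adelic) * (k : (quasiSplit F E c 2).Adelic))) ∂μK) =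
      (ideleSum F φ (AdeleRing.ideleRelNorm F E (diagUnit (t : borelAdelic F E c 2).2 0))⁻¹ -
          ((IdeleClassGroup.ideleNorm F (AdeleRing.ideleRelNorm F E (diagUnit (t : borelAdelic F E c 2).2 0))⁻¹ : ℝ) : ℂ)⁻¹ *
            {y : GaloisRepresentations.ideleGroup F |
                (IdeleClassGroup.ideleNorm F y : ℝ) < ((T : ℝ) / (borelHeight (1 : (quasiSplit F E c 2).Adelic) : ℝ))⁻¹}.indicator
              (fun _ => ((μA (adeleFundamentalDomain F)).toReal⁻¹ : ℂ) * adeleFourier F μA φ 0)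
              (AdeleRing.ideleRelNorm F E (diagUnit (t : borelAdelic F E c 2).2 0))⁻¹) *
        ((IdeleClassGroup.ideleNorm F (AdeleRing.ideleRelNorm F E (diagUnit (t : borelAdelic F E c 2).2 0))⁻¹ : ℝ) : ℂ) :=
  lineTorusIntegrand_normalForm_of_parts_two ν 𝓕 i f μK μA φ hT t
    (integral_tsum_line_torus_mul_eq_ideleSum_two hij hN ζ μK hcδ hδ hz₁ hf hfc t φ hφ)
    (integrable_tsum_rationalUnipotent_mul_two μK z₁ hf hfc _).2
    (integral_kernelBorelTailClass_torus_mul_eq_two' ζ hc hc1 ν h𝓕 hclN hz₁ hcl hfc hf T μK t)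
    (integrable_kernelBorelTailClass_torus_mul_two ζ hc hc1 ν h𝓕 hclN hz₁ hcl hfc hf T μK t) hν

end Discharged

/-! ## §3 All three letters discharged; the guarded integrand for ★ `lineTorusStage_eq_linear_two` -/

section Closed

variable (ζ : ratOne F E c) {z₁ : (quasiSplit F E c 2).arithmeticSubgroup}
  [LocallyCompactSpace (AdeleRing (𝓞 E) E)] [MeasurableSpace (AdeleRing (𝓞 E) E)] [BorelSpace (AdeleRing (𝓞 E) E)]
  [MeasurableSpace (adelicUnipotent F E c 2)] [BorelSpace (adelicUnipotent F E c 2)]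
  [MeasurableSpace (quasiSplit F E c 2).Adelic] [BorelSpace (quasiSplit F E c 2).Adelic]
  [MeasurableSpace (AdeleRing (𝓞 F) F)] [BorelSpace (AdeleRing (𝓞 F) F)]

/-- **THE NORMAL FORM OF THE TORUS INTEGRAND OF THE `U(J₂)` UNIPOTENT TERM — CLOSED** (every `T > 0`, every `t ∈ T(𝔸_F)`; the three
analytic letters (ET-κ)_two, (ET-β)_two, (ET-ν)_two discharged by name): for the central class `𝔬 = {charpoly = (X − ζ)²}` (`hcl`, `hclN`),
`z₁ = ζ·1`, ANY Haar `ν` on `N(𝔸_F)` and ANY fundamental domain `𝓕` of `N(F)` (the kernel letters' normalisation), `f ∈ C_c(G(𝔸_F))`,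
Haar `μ_K` on `K_U`, an additive Haar measure `μ_A` of `𝔸_F`, and the line profile `φ(x) = ∫_K f(k⁻¹ (z₁ n(θ x)) k) dμ_K`:
`δ_B(t)⁻¹ • ∫_K ψ_T(t k) dμ_K = (Σφ(x_t) − ‖x_t‖⁻¹ 1_{‖x_t‖ < (T∕H(1))⁻¹} μ_A(D_F)⁻¹ 𝔉φ(0)) · ‖x_t‖`, `x_t = (N_{E∕F} d₀ t)⁻¹` — Rogawski's
`G = U(2)` unipotent term integrand in Tate's currency, `V₀ = 1`. [cite: Rogawski1990, Prop. 7.3.1 (p. 98)] [cite: CasselsFrohlichANT1967, Ch. XV Thm. 4.1.3] -/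
theorem lineTorusIntegrand_normalForm_two {cl : (quasiSplit F E c 2).arithmeticSubgroup → ι}
    (hc : c * c = 1) (hc1 : c ≠ 1)
    (ν : Measure (adelicUnipotent F E c 2)) [ν.IsHaarMeasure]
    {𝓕 : Set (adelicUnipotent F E c 2)} (h𝓕 : IsFundamentalDomain (rationalUnipotent F E c 2) 𝓕 ν)
    (hclN : IsUnipotentInvariantOnBorel F E c 2 cl)
    (hz₁ : (z₁ : (quasiSplit F E c 2).Adelic) =
      (quasiSplit F E c 2).toAdelic (ratCenter F E c 2 ((StdForm.antidiagonal 2).over E) ζ))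
    {i : ι} (hcl : ∀ γ : (quasiSplit F E c 2).arithmeticSubgroup, cl γ = i ↔
      ((adelicVal F E c 2 _ (γ : (quasiSplit F E c 2).Adelic) : GL (Fin 2) (AdeleRing (𝓞 E) E)) :
          Matrix (Fin 2) (Fin 2) (AdeleRing (𝓞 E) E)).charpoly =
        ((X - C ((ζ : Eˣ) : E)) ^ 2).map (algebraMap E (AdeleRing (𝓞 E) E)))
    {f : (quasiSplit F E c 2).Adelic → ℂ} (hfc : Continuous f) (hf : HasCompactSupport f)
    (μK : Measure ((standardMaximalCompactGL 2 E).comap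
      (adelicVal F E c 2 ((StdForm.antidiagonal 2).over E)) : Subgroup (quasiSplit F E c 2).Adelic))
    [μK.IsHaarMeasure]
    {δ : E} (hcδ : c δ = -δ) (hδ : δ ≠ 0)
    (μA : Measure (AdeleRing (𝓞 F) F)) [μA.IsAddHaarMeasure] (φ : AdeleRing (𝓞 F) F → ℂ)
    (hφ : ∀ x : AdeleRing (𝓞 F) F, φ x = ∫ k, f ((k : (quasiSplit F E c 2).Adelic)⁻¹ *
      ((z₁ : (quasiSplit F E c 2).Adelic) *
        ((middleRootUnipotent hij hN (Multiplicative.ofAdd (traceZeroLine F E c hcδ hδ x)) :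
          adelicUnipotent F E c 2) : (quasiSplit F E c 2).Adelic)) * (k : (quasiSplit F E c 2).Adelic)) ∂μK)
    {T : ℝ≥0} (hT : 0 < (T : ℝ)) (t : torusInBorel F E c 2) :
    ((torusRootModulus E 2 (diagUnit (t : borelAdelic F E c 2).2) : ℝ≥0) : ℝ)⁻¹ •
        (∫ k, ((∑' u : {u : rationalUnipotent F E c 2 // u ≠ 1},
            f ((((t : borelAdelic F E c 2) : (quasiSplit F E c 2).Adelic) * (k : (quasiSplit F E c 2).Adelic))⁻¹ *
              ((z₁ * ⟨(((u.1 : rationalUnipotent F E c 2) : adelicUnipotent F E c 2) : (quasiSplit F E c 2).Adelic),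
                (u.1 : rationalUnipotent F E c 2).2⟩ : (quasiSplit F E c 2).arithmeticSubgroup) : (quasiSplit F E c 2).Adelic) *
                (((t : borelAdelic F E c 2) : (quasiSplit F E c 2).Adelic) * (k : (quasiSplit F E c 2).Adelic)))) -
          kernelBorelTailClass ν 𝓕 T cl i f
            (((t : borelAdelic F E c 2) : (quasiSplit F E c 2).Adelic) * (k : (quasiSplit F E c 2).Adelic))) ∂μK) =
      (ideleSum F φ (AdeleRing.ideleRelNorm F E (diagUnit (t : borelAdelic F E c 2).2 0))⁻¹ -
          ((IdeleClassGroup.ideleNorm F (AdeleRing.ideleRelNorm F E (diagUnit (t : borelAdelic F E c 2).2 0))⁻¹ : ℝ) : ℂ)⁻¹ *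
            {y : GaloisRepresentations.ideleGroup F |
                (IdeleClassGroup.ideleNorm F y : ℝ) < ((T : ℝ) / (borelHeight (1 : (quasiSplit F E c 2).Adelic) : ℝ))⁻¹}.indicator
              (fun _ => ((μA (adeleFundamentalDomain F)).toReal⁻¹ : ℂ) * adeleFourier F μA φ 0)
              (AdeleRing.ideleRelNorm F E (diagUnit (t : borelAdelic F E c 2).2 0))⁻¹) *
        ((IdeleClassGroup.ideleNorm F (AdeleRing.ideleRelNorm F E (diagUnit (t : borelAdelic F E c 2).2 0))⁻¹ : ℝ) : ℂ) := by
  refine lineTorusIntegrand_normalForm_of_parts_two' hij hN ζ hc hc1 ν h𝓕 hclN hz₁ hcl hfc hf μK hcδ hδ μA φ hφ hT t ?_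
  rw [inv_mul_integral_eq_inv_mul_integral_traceZeroLine_two hij hN hcδ hδ hc μA ν h𝓕]
  have hint : ∫ x : AdeleRing (𝓞 F) F, (∫ k : ((standardMaximalCompactGL 2 E).comap
        (adelicVal F E c 2 ((StdForm.antidiagonal 2).over E)) : Subgroup (quasiSplit F E c 2).Adelic),
      f ((k : (quasiSplit F E c 2).Adelic)⁻¹ * ((z₁ : (quasiSplit F E c 2).Adelic) *
        ((middleRootUnipotent hij hN (Multiplicative.ofAdd (traceZeroLine F E c hcδ hδ x)) :
          adelicUnipotent F E c 2) : (quasiSplit F E c 2).Adelic)) * (k : (quasiSplit F E c 2).Adelic)) ∂μK) ∂μA =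
      adeleFourier F μA φ 0 := by
    rw [adeleFourier]
    refine integral_congr_ae (ae_of_all _ fun x => ?_)
    simp only [mul_zero, AddChar.map_zero_eq_one, Circle.coe_one, mul_one]
    exact (hφ x).symm
  rw [hint, Complex.ofReal_inv]

/-- **THE GUARDED TORUS INTEGRAND FOR ★ `lineTorusStage_eq_linear_two` ∕ ★ `exists_pushConst_forall_lineTorusStage_eq_two`.** With
`Θ′ T t := if 0 < T then ∫_K ψ_T(t k) dμ_K else δ_B(t) · G_T(x_t)` (the bracket average at every `T > 0`; at `T = 0`, where the
bracket average does NOT have the normal form — the tail is the full `δ_B(t)(ν𝓕)⁻¹∫_N` term while the cut-off set `{‖y‖ < (0∕H₁)⁻¹ = 0}` is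
empty — the harmless value that does), the `hΘ` binder of the push holds for ALL `T : ℝ≥0` with `f := φ`, `H₁ := H(1)`, `V₀ := 1`:
`δ_B(t)⁻¹ • Θ′ T t = ↑(1 : ℝ) · (Σφ(x_t) − ‖x_t‖⁻¹ 1_{‖x_t‖ < (T∕H(1))⁻¹} μ_A(D_F)⁻¹ 𝔉φ(0)) · ‖x_t‖`. The (σ-u) head evaluates
`∫_T (w_T δ_B⁻¹) • Θ′ T dμ_T` by the push and replaces `Θ′ T` by the bracket average for `T > 0`. [cite: Rogawski1990, Prop. 7.3.1 (p. 98)] -/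
theorem lineTorusIntegrand_normalForm_guarded_two {cl : (quasiSplit F E c 2).arithmeticSubgroup → ι}
    (hc : c * c = 1) (hc1 : c ≠ 1)
    (ν : Measure (adelicUnipotent F E c 2)) [ν.IsHaarMeasure]
    {𝓕 : Set (adelicUnipotent F E c 2)} (h𝓕 : IsFundamentalDomain (rationalUnipotent F E c 2) 𝓕 ν)
    (hclN : IsUnipotentInvariantOnBorel F E c 2 cl)
    (hz₁ : (z₁ : (quasiSplit F E c 2).Adelic) =
      (quasiSplit F E c 2).toAdelic (ratCenter F E c 2 ((StdForm.antidiagonal 2).over E) ζ))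
    {i : ι} (hcl : ∀ γ : (quasiSplit F E c 2).arithmeticSubgroup, cl γ = i ↔
      ((adelicVal F E c 2 _ (γ : (quasiSplit F E c 2).Adelic) : GL (Fin 2) (AdeleRing (𝓞 E) E)) :
          Matrix (Fin 2) (Fin 2) (AdeleRing (𝓞 E) E)).charpoly =
        ((X - C ((ζ : Eˣ) : E)) ^ 2).map (algebraMap E (AdeleRing (𝓞 E) E)))
    {f : (quasiSplit F E c 2).Adelic → ℂ} (hfc : Continuous f) (hf : HasCompactSupport f)
    (μK : Measure ((standardMaximalCompactGL 2 E).comap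
      (adelicVal F E c 2 ((StdForm.antidiagonal 2).over E)) : Subgroup (quasiSplit F E c 2).Adelic))
    [μK.IsHaarMeasure]
    {δ : E} (hcδ : c δ = -δ) (hδ : δ ≠ 0)
    (μA : Measure (AdeleRing (𝓞 F) F)) [μA.IsAddHaarMeasure] (φ : AdeleRing (𝓞 F) F → ℂ)
    (hφ : ∀ x : AdeleRing (𝓞 F) F, φ x = ∫ k, f ((k : (quasiSplit F E c 2).Adelic)⁻¹ *
      ((z₁ : (quasiSplit F E c 2).Adelic) *
        ((middleRootUnipotent hij hN (Multiplicative.ofAdd (traceZeroLine F E c hcδ hδ x)) :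
          adelicUnipotent F E c 2) : (quasiSplit F E c 2).Adelic)) * (k : (quasiSplit F E c 2).Adelic)) ∂μK) :
    ∀ (T : ℝ≥0) (t : torusInBorel F E c 2),
      ((torusRootModulus E 2 (diagUnit (t : borelAdelic F E c 2).2) : ℝ≥0) : ℝ)⁻¹ •
          (if 0 < (T : ℝ) then
              ∫ k, ((∑' u : {u : rationalUnipotent F E c 2 // u ≠ 1},
                  f ((((t : borelAdelic F E c 2) : (quasiSplit F E c 2).Adelic) * (k : (quasiSplit F E c 2).Adelic))⁻¹ *
                    ((z₁ * ⟨(((u.1 : rationalUnipotent F E c 2) : adelicUnipotent F E c 2) : (quasiSplit F E c 2).Adelic),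
                      (u.1 : rationalUnipotent F E c 2).2⟩ : (quasiSplit F E c 2).arithmeticSubgroup) :
                      (quasiSplit F E c 2).Adelic) *
                      (((t : borelAdelic F E c 2) : (quasiSplit F E c 2).Adelic) * (k : (quasiSplit F E c 2).Adelic)))) -
                kernelBorelTailClass ν 𝓕 T cl i f
                  (((t : borelAdelic F E c 2) : (quasiSplit F E c 2).Adelic) * (k : (quasiSplit F E c 2).Adelic))) ∂μK
            else
              (((torusRootModulus E 2 (diagUnit (t : borelAdelic F E c 2).2) : ℝ≥0) : ℝ) : ℂ) *
                (((1 : ℝ) : ℂ) *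
                  ((ideleSum F φ (AdeleRing.ideleRelNorm F E (diagUnit (t : borelAdelic F E c 2).2 0))⁻¹ -
                      ((IdeleClassGroup.ideleNorm F
                          (AdeleRing.ideleRelNorm F E (diagUnit (t : borelAdelic F E c 2).2 0))⁻¹ : ℝ) : ℂ)⁻¹ *
                        {y : GaloisRepresentations.ideleGroup F |
                            (IdeleClassGroup.ideleNorm F y : ℝ) <
                              ((T : ℝ) / (borelHeight (1 : (quasiSplit F E c 2).Adelic) : ℝ))⁻¹}.indicator
                          (fun _ => ((μA (adeleFundamentalDomain F)).toReal⁻¹ : ℂ) * adeleFourier F μA φ 0)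
                          (AdeleRing.ideleRelNorm F E (diagUnit (t : borelAdelic F E c 2).2 0))⁻¹) *
                    ((IdeleClassGroup.ideleNorm F
                        (AdeleRing.ideleRelNorm F E (diagUnit (t : borelAdelic F E c 2).2 0))⁻¹ : ℝ) : ℂ)))) =
        ((1 : ℝ) : ℂ) *
          ((ideleSum F φ (AdeleRing.ideleRelNorm F E (diagUnit (t : borelAdelic F E c 2).2 0))⁻¹ -
              ((IdeleClassGroup.ideleNorm F (AdeleRing.ideleRelNorm F E (diagUnit (t : borelAdelic F E c 2).2 0))⁻¹ : ℝ) : ℂ)⁻¹ *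
                {y : GaloisRepresentations.ideleGroup F |
                    (IdeleClassGroup.ideleNorm F y : ℝ) < ((T : ℝ) / (borelHeight (1 : (quasiSplit F E c 2).Adelic) : ℝ))⁻¹}.indicator
                  (fun _ => ((μA (adeleFundamentalDomain F)).toReal⁻¹ : ℂ) * adeleFourier F μA φ 0)
                  (AdeleRing.ideleRelNorm F E (diagUnit (t : borelAdelic F E c 2).2 0))⁻¹) *
            ((IdeleClassGroup.ideleNorm F (AdeleRing.ideleRelNorm F E (diagUnit (t : borelAdelic F E c 2).2 0))⁻¹ : ℝ) : ℂ)) := by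
  intro T t
  by_cases hT : 0 < (T : ℝ)
  · rw [if_pos hT, lineTorusIntegrand_normalForm_two hij hN ζ hc hc1 ν h𝓕 hclN hz₁ hcl hfc hf μK hcδ hδ μA φ hφ hT t,
      Complex.ofReal_one, one_mul]
  · have hδ0 : (((torusRootModulus E 2 (diagUnit (t : borelAdelic F E c 2).2) : ℝ≥0) : ℝ) : ℂ) ≠ 0 := by
      rw [torusRootModulus_diagUnit_eq_ideleNorm_ideleRelNorm_two]
      exact_mod_cast ideleNorm_ne_zero (AdeleRing.ideleRelNorm F E (diagUnit (t : borelAdelic F E c 2).2 0))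
    rw [if_neg hT, Complex.real_smul, Complex.ofReal_inv, inv_mul_cancel_left₀ hδ0]

end Closed

end UnitaryGroup

end Literature.NumberTheory.Automorphic

end
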